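import Literature.NumberTheory.Sieve.FriedlanderIwaniecPrimesJacobiTwistedDualBound
import HarnessLib

/-!
# Friedlander–Iwaniec, *The polynomial `X² + Y⁴` captures its primes*, §11: duality, trivial bounds and the symmetry `r ↔ s` ((11.24))

Family `parity`, statement parity.S17 (`setOf_prime_sq_add_pow_four_infinite`). Source: J. Friedlander,
H. Iwaniec, Ann. of Math. (2) 148 (1998), 945–1040 [FriedlanderIwaniecAnnals1998], §11, proof of
Proposition 11.1, pp. 989–991: the duality (11.14) ⟺ (11.19); "if `D > RS` the estimate (11.23) is
trivial"; "First we look at the sum `W*(D)` reduced by the condition `(a, d') = 1` … if we switch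
`r` with `s` and also change `γ_{ad}` to `γ_{ad} (a/d')` then `W*(D)` is not altered. Therefore due
to this symmetry we may assume that `R ≤ S`. Applying (11.23) we get (11.24)".

Seventh file of the §§11–14 unit. Everything is PROVED; definitions: `IsUnitSupported` (vectors
`γ_{ad}` supported on the classes with `(a, d) = 1` — the printed `(a, d') = 1` does not make the
switch well defined when `a` and `d` are both even, so the unit classes are used; the difference is
absorbed by the removal step of the sequel, which pulls out the full `e = (a, d)`), `invMod`
(`b̄ mod d`), `jtFlip` (the switched vector `γ'_d(b) = γ_d(b̄) χ_d(b̄)`).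

* `jtV_le_of_forall_jtW_le` — duality for `V`/`W` (`duality_principle` of `…JacobiTwistedTools`);
* `jtW_le_trivial` — `W ≤ (D₂−D₁) R (S/(D₁+1) + 1) ‖γ‖²`; `jtV_le_of_large_level` — for `D₁ ≥ 4RS`,
  `V ≤ (D₂−D₁) min(R,S) ‖α‖²` (`card_class_le_min`: a class then has `≤ min(R,S)` elements);
* `jtW_eq_jtW_jtFlip` — **the symmetry** `W(γ; R, S) = W(γ'; S, R)` for unit-supported `γ`, with
  `jtNormSq_jtFlip` (`‖γ'‖ = ‖γ‖`), via `invMod_congrSol`, `jtChar_congrSol_mul`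
  (`χ_d(s r̄) χ_d(s) = χ_d(r)`), `not_coprime_congrSol`;
* **`exists_jtW_le_unitSupported` — (11.24)** in the symmetric form
  `W ≤ C {RS√D₂/(D₁+1) + (S R^{3/4} + R S^{3/4} + D₂√(RS)) (D₂RS)^ε} ‖γ‖²` for unit-supported `γ`.

## References

* J. Friedlander, H. Iwaniec, Ann. of Math. (2) 148 (1998), 945–1040, §11, (11.14), (11.19), (11.24).
  [FriedlanderIwaniecAnnals1998]

## Tree / Mathlib

Tree: `jtV`, `jtW`, `jtNormSq`, `jtChar`, `congrSol` and their API (`…JacobiTwistedForms`),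
`exists_jtW_le` (`…JacobiTwistedDualBound`), `duality_principle` (`…JacobiTwistedTools`),
`card_le_of_forall_dvd_sub_int` (`…JacobiTwistedPairBound`). Mathlib: `ZMod.unitOfCoprime`,
`ZMod.inv_coe_unit`, `ZMod.val_coe_unit_coprime`, `Int.eq_zero_of_abs_lt_dvd`, `Finset.sum_nbij'`.
-/

noncomputable section

open Finset Real Complex MeasureTheory
open scoped FourierTransform ContDiff ComplexConjugate NumberTheorySymbols ArithmeticFunction.sigma Nat

namespace Literature.NumberTheory.Sieve.FriedlanderIwaniecPrimes

open LargeSieve (e)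



/-! ### Duality for `V(D)` and `W(D)` -/

/-- **Duality for `V(D)` and `W(D)`** ("the estimate (11.14) is equivalent to (11.19)"): a bound
`W(γ) ≤ Δ ‖γ‖²` for all `γ` gives `V(α) ≤ Δ ‖α‖²` for all `α`.
[cite: FriedlanderIwaniecAnnals1998, §11, (11.18)-(11.19)] -/
theorem jtV_le_of_forall_jtW_le {D₁ D₂ R S : ℕ} {Δ : ℝ} (hΔ : 0 ≤ Δ)
    (h : ∀ γ : ℕ → ℕ → ℂ, jtW D₁ D₂ R S γ ≤ Δ * jtNormSq D₁ D₂ γ) (α : ℕ → ℕ → ℂ) :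
    jtV D₁ D₂ R S α ≤ Δ * ∑ r ∈ Ioc R (2 * R), ∑ s ∈ Ioc S (2 * S), ‖α r s‖ ^ 2 := by
  classical
  set sI := (Ioc D₁ D₂).sigma (fun d => range d) with hsI
  set tJ := Ioc R (2 * R) ×ˢ Ioc S (2 * S) with htJ
  set M : (Σ _ : ℕ, ℕ) → ℕ × ℕ → ℂ := fun i j =>
    if j.1.Coprime i.1 ∧ (i.1 : ℤ) ∣ (j.2 : ℤ) - (i.2 : ℤ) * j.1 then (jtChar i.1 j.1 : ℂ) else 0 with hM
  have hhyp : ∀ x : (Σ _ : ℕ, ℕ) → ℂ,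
      ∑ j ∈ tJ, ‖∑ i ∈ sI, M i j * x i‖ ^ 2 ≤ Δ * ∑ i ∈ sI, ‖x i‖ ^ 2 := by
    intro x
    have hW := h (fun d a => x ⟨d, a⟩)
    rw [jtW_def, jtNormSq_def] at hW
    have e1 : ∑ j ∈ tJ, ‖∑ i ∈ sI, M i j * x i‖ ^ 2 =
        ∑ r ∈ Ioc R (2 * R), ∑ s ∈ Ioc S (2 * S), ‖∑ d ∈ Ioc D₁ D₂, ∑ a ∈ range d,
          (if r.Coprime d ∧ (d : ℤ) ∣ (s : ℤ) - (a : ℤ) * r then x ⟨d, a⟩ * (jtChar d r : ℂ) else 0)‖ ^ 2 := by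
      rw [htJ, sum_product]
      refine sum_congr rfl fun r _ => sum_congr rfl fun s _ => ?_
      rw [hsI, sum_sigma]
      congr 2
      refine sum_congr rfl fun d _ => sum_congr rfl fun a _ => ?_
      rw [hM]; dsimp only; split_ifs <;> ring
    have e2 : ∑ i ∈ sI, ‖x i‖ ^ 2 = ∑ d ∈ Ioc D₁ D₂, ∑ a ∈ range d, ‖x ⟨d, a⟩‖ ^ 2 := by
      rw [hsI, sum_sigma]
    rw [e1, e2]; exact hW
  have hdual := duality_principle sI tJ M hΔ hhyp (fun j => α j.1 j.2)
  have e3 : ∑ i ∈ sI, ‖∑ j ∈ tJ, M i j * α j.1 j.2‖ ^ 2 = jtV D₁ D₂ R S α := by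
    rw [jtV_def, hsI, sum_sigma]
    refine sum_congr rfl fun d _ => sum_congr rfl fun a _ => ?_
    rw [htJ, sum_product]
    congr 2
    refine sum_congr rfl fun r _ => sum_congr rfl fun s' _ => ?_
    rw [hM]; dsimp only; split_ifs <;> ring
  have e4 : ∑ j ∈ tJ, ‖α j.1 j.2‖ ^ 2 = ∑ r ∈ Ioc R (2 * R), ∑ s ∈ Ioc S (2 * S), ‖α r s‖ ^ 2 := by
    rw [htJ, sum_product]
  rw [e3, e4] at hdual
  exact hdual

/-! ### Trivial bounds -/

/-- `‖∑_{d ∈ A} x_d‖² ≤ #A ∑_{d ∈ A} ‖x_d‖²`. [folklore] -/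
theorem norm_sum_sq_le_card_mul {ι : Type*} (A : Finset ι) (x : ι → ℂ) :
    ‖∑ d ∈ A, x d‖ ^ 2 ≤ #A * ∑ d ∈ A, ‖x d‖ ^ 2 := by
  calc ‖∑ d ∈ A, x d‖ ^ 2 ≤ (∑ d ∈ A, ‖x d‖) ^ 2 := pow_le_pow_left₀ (norm_nonneg _) (norm_sum_le _ _) 2
    _ = (∑ d ∈ A, 1 * ‖x d‖) ^ 2 := by simp
    _ ≤ (∑ d ∈ A, (1 : ℝ) ^ 2) * ∑ d ∈ A, ‖x d‖ ^ 2 := sum_mul_sq_le_sq_mul_sq A _ _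
    _ = #A * ∑ d ∈ A, ‖x d‖ ^ 2 := by simp

/-- For `(r, d) = 1`, the `s ∈ (S, 2S]` with `s r̄ ≡ a (mod d)` number at most `S/d + 1`. [folklore] -/
theorem card_Ioc_filter_congrSol_le {d r : ℕ} (hd : 0 < d) (hr : r.Coprime d) (S a : ℕ) :
    (#((Ioc S (2 * S)).filter fun s => congrSol d r s = a) : ℝ) ≤ (S : ℝ) / d + 1 := by
  have h := card_le_of_forall_dvd_sub_int (F := ((Ioc S (2 * S)).filter fun s => congrSol d r s = a).map
      Nat.castEmbedding) (lo := (S : ℤ) + 1) (hi := 2 * S) (q := d)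
    (fun x hx => by
      rw [mem_map] at hx
      obtain ⟨s, hs, rfl⟩ := hx
      rw [mem_filter, mem_Ioc] at hs
      simp only [Nat.castEmbedding_apply]; omega)
    (fun x hx y hy => by
      rw [mem_map] at hx hy
      obtain ⟨s, hs, rfl⟩ := hx
      obtain ⟨s', hs', rfl⟩ := hy
      rw [mem_filter, mem_Ioc] at hs hs'
      simp only [Nat.castEmbedding_apply]
      have h1 := dvd_sub_congrSol_mul hd hr s
      have h2 := dvd_sub_congrSol_mul hd hr s'
      rw [hs.2] at h1; rw [hs'.2] at h2
      have := dvd_sub h1 h2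
      have he : (s : ℤ) - (a : ℤ) * r - ((s' : ℤ) - (a : ℤ) * r) = (s : ℤ) - s' := by ring
      rwa [he] at this)
  rw [card_map] at h
  have h2 : ((2 * S : ℤ) - ((S : ℤ) + 1)).toNat ≤ S := by omega
  calc (#((Ioc S (2 * S)).filter fun s => congrSol d r s = a) : ℝ)
      ≤ ((((2 * S : ℤ) - ((S : ℤ) + 1)).toNat / d + 1 : ℕ) : ℝ) := by exact_mod_cast h
    _ ≤ ((S / d + 1 : ℕ) : ℝ) := by exact_mod_cast Nat.add_le_add_right (Nat.div_le_div_right h2) 1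
    _ ≤ (S : ℝ) / d + 1 := by
        push_cast
        have hcd : ((S / d : ℕ) : ℝ) ≤ (S : ℝ) / d := Nat.cast_div_le
        linarith

/-- **The trivial bound for `W(D)`:** `W ≤ (D₂ − D₁) R (S/(D₁+1) + 1) ‖γ‖²` (for `𝒟 = (D, 2D]` this is
`W(D) ≪ (RS + DR) ‖γ‖²`). [cite: FriedlanderIwaniecAnnals1998, §11, after (11.23)] -/
theorem jtW_le_trivial (D₁ D₂ R S : ℕ) (γ : ℕ → ℕ → ℂ) :
    jtW D₁ D₂ R S γ ≤ ((D₂ - D₁ : ℕ) : ℝ) * R * ((S : ℝ) / (D₁ + 1) + 1) * jtNormSq D₁ D₂ γ := by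
  rw [jtW_eq_sum_congrSol]
  set 𝒟 := Ioc D₁ D₂ with h𝒟
  have h𝒟card : #𝒟 = D₂ - D₁ := Nat.card_Ioc _ _
  have h𝒟pos : ∀ d ∈ 𝒟, 0 < d ∧ (D₁ : ℝ) + 1 ≤ d := fun d hd => by
    rw [mem_Ioc] at hd; exact ⟨by omega, by exact_mod_cast hd.1⟩
  -- Cauchy–Schwarz in `d`
  have h1 : ∀ r s : ℕ, ‖∑ d ∈ 𝒟.filter (fun d => r.Coprime d), γ d (congrSol d r s) * (jtChar d r : ℂ)‖ ^ 2 ≤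
      #𝒟 * ∑ d ∈ 𝒟.filter (fun d => r.Coprime d), ‖γ d (congrSol d r s)‖ ^ 2 := by
    intro r s
    refine (norm_sum_sq_le_card_mul _ _).trans ?_
    refine mul_le_mul (by exact_mod_cast card_le_card (filter_subset _ _)) (sum_le_sum fun d _ => ?_)
      (sum_nonneg fun _ _ => by positivity) (Nat.cast_nonneg _)
    rw [norm_mul]
    calc (‖γ d (congrSol d r s)‖ * ‖(jtChar d r : ℂ)‖) ^ 2 ≤ (‖γ d (congrSol d r s)‖ * 1) ^ 2 := by
          gcongr; exact norm_jtChar_le_one d r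
      _ = _ := by rw [mul_one]
  -- count for each `d`
  have h2 : ∀ d ∈ 𝒟, ∀ r : ℕ, r.Coprime d →
      ∑ s ∈ Ioc S (2 * S), ‖γ d (congrSol d r s)‖ ^ 2 ≤ ((S : ℝ) / (D₁ + 1) + 1) * ∑ a ∈ range d, ‖γ d a‖ ^ 2 := by
    intro d hd r hr
    obtain ⟨hd0, hdD⟩ := h𝒟pos d hd
    rw [← sum_fiberwise_of_maps_to (s := Ioc S (2 * S)) (t := range d) (g := fun s => congrSol d r s)
      (fun s _ => mem_range.mpr (congrSol_lt hd0 r s)), mul_sum]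
    refine sum_le_sum fun a _ => ?_
    calc ∑ s ∈ (Ioc S (2 * S)).filter (fun s => congrSol d r s = a), ‖γ d (congrSol d r s)‖ ^ 2
        = #((Ioc S (2 * S)).filter fun s => congrSol d r s = a) * ‖γ d a‖ ^ 2 := by
          rw [sum_congr rfl fun s hs => by rw [(mem_filter.mp hs).2], sum_const, nsmul_eq_mul]
      _ ≤ ((S : ℝ) / d + 1) * ‖γ d a‖ ^ 2 :=
          mul_le_mul_of_nonneg_right (card_Ioc_filter_congrSol_le hd0 hr S a) (by positivity)
      _ ≤ ((S : ℝ) / (D₁ + 1) + 1) * ‖γ d a‖ ^ 2 := by gcongr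
  -- assemble
  set M : ℝ := (S : ℝ) / (D₁ + 1) + 1 with hM
  have hM0 : 0 ≤ M := by positivity
  have hu0 : ∀ d, 0 ≤ ∑ a ∈ range d, ‖γ d a‖ ^ 2 := fun d => sum_nonneg fun _ _ => by positivity
  calc ∑ r ∈ Ioc R (2 * R), ∑ s ∈ Ioc S (2 * S),
        ‖∑ d ∈ 𝒟.filter (fun d => r.Coprime d), γ d (congrSol d r s) * (jtChar d r : ℂ)‖ ^ 2
      ≤ ∑ r ∈ Ioc R (2 * R), ∑ s ∈ Ioc S (2 * S),
          (#𝒟 : ℝ) * ∑ d ∈ 𝒟.filter (fun d => r.Coprime d), ‖γ d (congrSol d r s)‖ ^ 2 :=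
        sum_le_sum fun r _ => sum_le_sum fun s _ => h1 r s
    _ = (#𝒟 : ℝ) * ∑ r ∈ Ioc R (2 * R), ∑ d ∈ 𝒟.filter (fun d => r.Coprime d),
          ∑ s ∈ Ioc S (2 * S), ‖γ d (congrSol d r s)‖ ^ 2 := by
        rw [mul_sum]
        refine sum_congr rfl fun r _ => ?_
        rw [← mul_sum, sum_comm]
    _ ≤ (#𝒟 : ℝ) * ∑ r ∈ Ioc R (2 * R), ∑ d ∈ 𝒟, M * ∑ a ∈ range d, ‖γ d a‖ ^ 2 := by
        refine mul_le_mul_of_nonneg_left (sum_le_sum fun r _ => ?_) (Nat.cast_nonneg _)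
        calc ∑ d ∈ 𝒟.filter (fun d => r.Coprime d), ∑ s ∈ Ioc S (2 * S), ‖γ d (congrSol d r s)‖ ^ 2
            ≤ ∑ d ∈ 𝒟.filter (fun d => r.Coprime d), M * ∑ a ∈ range d, ‖γ d a‖ ^ 2 :=
              sum_le_sum fun d hd => h2 d (mem_filter.mp hd).1 r (mem_filter.mp hd).2
          _ ≤ ∑ d ∈ 𝒟, M * ∑ a ∈ range d, ‖γ d a‖ ^ 2 :=
              sum_le_sum_of_subset_of_nonneg (filter_subset _ _) fun d _ _ => mul_nonneg hM0 (hu0 d)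
    _ = ((D₂ - D₁ : ℕ) : ℝ) * R * M * jtNormSq D₁ D₂ γ := by
        have hRc : #(Ioc R (2 * R)) = R := by rw [Nat.card_Ioc]; omega
        rw [sum_const, nsmul_eq_mul, hRc, ← mul_sum, jtNormSq_def, h𝒟card]
        ring





/-! ### The direct bound for `V(D)` at a level `D₁ ≥ 4RS` -/

/-- **Classes are short when the modulus exceeds `4RS`:** for `d > 4RS`, `(r, d) = 1`-pairs
`(r, s), (r', s') ∈ (R,2R] × (S,2S]` in one class `s ≡ a r`, `s' ≡ a r' (mod d)` satisfy
`s r' = s' r`; hence the class has at most `min(R, S)` elements. [folklore] -/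
theorem card_class_le_min {d R S a : ℕ} (hd : 4 * R * S < d) :
    #(((Ioc R (2 * R)) ×ˢ (Ioc S (2 * S))).filter fun rs : ℕ × ℕ =>
      rs.1.Coprime d ∧ (d : ℤ) ∣ (rs.2 : ℤ) - (a : ℤ) * rs.1) ≤ min R S := by
  set C := ((Ioc R (2 * R)) ×ˢ (Ioc S (2 * S))).filter fun rs : ℕ × ℕ =>
      rs.1.Coprime d ∧ (d : ℤ) ∣ (rs.2 : ℤ) - (a : ℤ) * rs.1 with hC
  -- the key relation
  have hkey : ∀ p ∈ C, ∀ p' ∈ C, p.2 * p'.1 = p'.2 * p.1 := by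
    intro p hp p' hp'
    simp only [hC, mem_filter, mem_product, mem_Ioc] at hp hp'
    obtain ⟨⟨⟨h1, h2⟩, h3, h4⟩, -, hdvd⟩ := hp
    obtain ⟨⟨⟨h1', h2'⟩, h3', h4'⟩, -, hdvd'⟩ := hp'
    have hdiff : (d : ℤ) ∣ (p.2 : ℤ) * p'.1 - (p'.2 : ℤ) * p.1 := by
      have e : (p.2 : ℤ) * p'.1 - (p'.2 : ℤ) * p.1 =
          ((p.2 : ℤ) - a * p.1) * p'.1 - ((p'.2 : ℤ) - a * p'.1) * p.1 := by ring
      rw [e]; exact dvd_sub (hdvd.mul_right _) (hdvd'.mul_right _)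
    have hb1 : p.2 * p'.1 ≤ 4 * R * S := by nlinarith
    have hb2 : p'.2 * p.1 ≤ 4 * R * S := by nlinarith
    have habs : |(p.2 : ℤ) * p'.1 - (p'.2 : ℤ) * p.1| < d := by
      rw [abs_lt]; constructor <;> omega
    have := Int.eq_zero_of_abs_lt_dvd hdiff habs
    have h' : (p.2 : ℤ) * p'.1 = (p'.2 : ℤ) * p.1 := by linarith
    exact_mod_cast h'
  refine le_min ?_ ?_
  · -- `(r, s) ↦ r` is injective on the class
    calc #C ≤ #(Ioc R (2 * R)) := by
          refine card_le_card_of_injOn Prod.fst (fun p hp => ?_) (fun p hp p' hp' h => ?_)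
          · exact (mem_product.mp (mem_filter.mp (mem_coe.mp hp)).1).1
          · have hk := hkey p (mem_coe.mp hp) p' (mem_coe.mp hp')
            have hp1 : 0 < p'.1 := by
              have := (mem_Ioc.mp (mem_product.mp (mem_filter.mp (mem_coe.mp hp')).1).1).1; omega
            have h1 : p.1 = p'.1 := h
            rw [h1] at hk
            exact Prod.ext h1 (Nat.eq_of_mul_eq_mul_right hp1 hk)
      _ = R := by rw [Nat.card_Ioc]; omega
  · calc #C ≤ #(Ioc S (2 * S)) := by
          refine card_le_card_of_injOn Prod.snd (fun p hp => ?_) (fun p hp p' hp' h => ?_)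
          · exact (mem_product.mp (mem_filter.mp (mem_coe.mp hp)).1).2
          · have hk := hkey p (mem_coe.mp hp) p' (mem_coe.mp hp')
            have hp2 : 0 < p'.2 := by
              have := (mem_Ioc.mp (mem_product.mp (mem_filter.mp (mem_coe.mp hp')).1).2).1; omega
            have h2 : p.2 = p'.2 := h
            rw [h2] at hk
            exact Prod.ext (Nat.eq_of_mul_eq_mul_left hp2 hk).symm h2
      _ = S := by rw [Nat.card_Ioc]; omega

/-- **`V(D)` for moduli beyond `4RS`** (the regime "`D > RS`" of the source, where the estimate is
"trivial"): if `4RS ≤ D₁` then `V ≤ (D₂ − D₁) min(R, S) ‖α‖²` (each class has at most `min(R,S)`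
elements, `card_class_le_min`). [cite: FriedlanderIwaniecAnnals1998, §11, after (11.23)] -/
theorem jtV_le_of_large_level {D₁ D₂ R S : ℕ} (h : 4 * R * S ≤ D₁) (α : ℕ → ℕ → ℂ) :
    jtV D₁ D₂ R S α ≤ ((D₂ - D₁ : ℕ) : ℝ) * min (R : ℝ) S *
      ∑ r ∈ Ioc R (2 * R), ∑ s ∈ Ioc S (2 * S), ‖α r s‖ ^ 2 := by
  rw [jtV_def]
  set 𝒟 := Ioc D₁ D₂ with h𝒟
  set box := (Ioc R (2 * R)) ×ˢ (Ioc S (2 * S)) with hbox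
  set N2 : ℝ := ∑ r ∈ Ioc R (2 * R), ∑ s ∈ Ioc S (2 * S), ‖α r s‖ ^ 2 with hN2
  have hN2' : N2 = ∑ p ∈ box, ‖α p.1 p.2‖ ^ 2 := by rw [hN2, hbox, sum_product]
  have hmin0 : (0 : ℝ) ≤ min (R : ℝ) S := le_min (Nat.cast_nonneg _) (Nat.cast_nonneg _)
  -- per modulus
  have hd : ∀ d ∈ 𝒟, ∑ a ∈ range d, ‖∑ r ∈ Ioc R (2 * R), ∑ s ∈ Ioc S (2 * S),
      (if r.Coprime d ∧ (d : ℤ) ∣ (s : ℤ) - (a : ℤ) * r then α r s * (jtChar d r : ℂ) else 0)‖ ^ 2 ≤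
        min (R : ℝ) S * N2 := by
    intro d hdm
    rw [h𝒟, mem_Ioc] at hdm
    have hd4 : 4 * R * S < d := by omega
    -- the class of `a`
    set cls : ℕ → Finset (ℕ × ℕ) := fun a => box.filter fun rs : ℕ × ℕ =>
      rs.1.Coprime d ∧ (d : ℤ) ∣ (rs.2 : ℤ) - (a : ℤ) * rs.1 with hcls
    have hsum : ∀ a : ℕ, ∑ r ∈ Ioc R (2 * R), ∑ s ∈ Ioc S (2 * S),
        (if r.Coprime d ∧ (d : ℤ) ∣ (s : ℤ) - (a : ℤ) * r then α r s * (jtChar d r : ℂ) else 0) =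
        ∑ p ∈ cls a, α p.1 p.2 * (jtChar d p.1 : ℂ) := by
      intro a
      rw [hcls]; dsimp only; rw [sum_filter, hbox, sum_product]
    calc _ = ∑ a ∈ range d, ‖∑ p ∈ cls a, α p.1 p.2 * (jtChar d p.1 : ℂ)‖ ^ 2 :=
          sum_congr rfl fun a _ => by rw [hsum]
      _ ≤ ∑ a ∈ range d, (#(cls a) : ℝ) * ∑ p ∈ cls a, ‖α p.1 p.2‖ ^ 2 := by
          refine sum_le_sum fun a _ => (norm_sum_sq_le_card_mul _ _).trans ?_
          refine mul_le_mul_of_nonneg_left (sum_le_sum fun p _ => ?_) (Nat.cast_nonneg _)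
          rw [norm_mul]
          calc (‖α p.1 p.2‖ * ‖(jtChar d p.1 : ℂ)‖) ^ 2 ≤ (‖α p.1 p.2‖ * 1) ^ 2 := by
                gcongr; exact norm_jtChar_le_one _ _
            _ = _ := by rw [mul_one]
      _ ≤ ∑ a ∈ range d, min (R : ℝ) S * ∑ p ∈ cls a, ‖α p.1 p.2‖ ^ 2 := by
          refine sum_le_sum fun a _ => mul_le_mul_of_nonneg_right ?_ (sum_nonneg fun _ _ => by positivity)
          have hcl : #(cls a) ≤ min R S := card_class_le_min (R := R) (S := S) (a := a) hd4
          calc (#(cls a) : ℝ) ≤ ((min R S : ℕ) : ℝ) := Nat.cast_le.mpr hcl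
            _ = min (R : ℝ) S := Nat.cast_min R S
      _ = min (R : ℝ) S * ∑ a ∈ range d, ∑ p ∈ cls a, ‖α p.1 p.2‖ ^ 2 := by rw [mul_sum]
      _ ≤ min (R : ℝ) S * N2 := by
          refine mul_le_mul_of_nonneg_left ?_ hmin0
          -- the classes for distinct `a` are disjoint pieces of the box
          rw [hN2']
          calc ∑ a ∈ range d, ∑ p ∈ cls a, ‖α p.1 p.2‖ ^ 2
              = ∑ a ∈ range d, ∑ p ∈ box, (if p.1.Coprime d ∧ (d : ℤ) ∣ (p.2 : ℤ) - (a : ℤ) * p.1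
                  then ‖α p.1 p.2‖ ^ 2 else 0) := sum_congr rfl fun a _ => by rw [hcls]; dsimp only; rw [sum_filter]
            _ = ∑ p ∈ box, ∑ a ∈ range d, (if p.1.Coprime d ∧ (d : ℤ) ∣ (p.2 : ℤ) - (a : ℤ) * p.1
                  then ‖α p.1 p.2‖ ^ 2 else 0) := sum_comm
            _ ≤ ∑ p ∈ box, ‖α p.1 p.2‖ ^ 2 := by
                refine sum_le_sum fun p _ => ?_
                by_cases hcop : p.1.Coprime d
                · have hd0 : 0 < d := by omega
                  have heq : ∀ a ∈ range d, (if p.1.Coprime d ∧ (d : ℤ) ∣ (p.2 : ℤ) - (a : ℤ) * p.1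
                      then ‖α p.1 p.2‖ ^ 2 else 0) =
                      (if (d : ℤ) ∣ (p.2 : ℤ) - (a : ℤ) * p.1 then ‖α p.1 p.2‖ ^ 2 else 0) := by
                    intro a _
                    by_cases hdv : (d : ℤ) ∣ (p.2 : ℤ) - (a : ℤ) * p.1
                    · rw [if_pos ⟨hcop, hdv⟩, if_pos hdv]
                    · rw [if_neg (fun h => hdv h.2), if_neg hdv]
                  rw [sum_congr rfl heq, sum_range_ite_dvd_sub_mul hd0 hcop p.2 (fun _ => ‖α p.1 p.2‖ ^ 2)]
                · rw [sum_eq_zero fun a _ => if_neg fun h => hcop h.1]; positivity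
  calc _ ≤ ∑ d ∈ 𝒟, min (R : ℝ) S * N2 := sum_le_sum hd
    _ = _ := by rw [sum_const, h𝒟, Nat.card_Ioc, nsmul_eq_mul, hN2]; ring





/-! ### W7: the symmetry `r ↔ s` for vectors supported on unit classes -/

/-- `γ` is supported on the unit classes: `γ_d(a) = 0` unless `(a, d) = 1` (`D₁ < d ≤ D₂`, `a < d`).
[cite: FriedlanderIwaniecAnnals1998, §11, before (11.24)] -/
def IsUnitSupported (D₁ D₂ : ℕ) (γ : ℕ → ℕ → ℂ) : Prop :=
  ∀ d ∈ Ioc D₁ D₂, ∀ a : ℕ, a < d → ¬a.Coprime d → γ d a = 0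

/-- The inverse class `b̄ (mod d)` as a natural number `< d`. [folklore] -/
def invMod (d b : ℕ) : ℕ := ((b : ZMod d)⁻¹).val

/-- Unfolding `invMod`. [folklore] -/
theorem invMod_def (d b : ℕ) : invMod d b = ((b : ZMod d)⁻¹).val := rfl

/-- `b̄ mod d < d`. [folklore] -/
theorem invMod_lt {d : ℕ} (hd : 0 < d) (b : ℕ) : invMod d b < d := by
  haveI : NeZero d := ⟨hd.ne'⟩; exact ZMod.val_lt _

/-- `(b̄ : ZMod d) = b⁻¹`. [folklore] -/
theorem natCast_invMod {d : ℕ} (hd : 0 < d) (b : ℕ) : ((invMod d b : ℕ) : ZMod d) = (b : ZMod d)⁻¹ := by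
  haveI : NeZero d := ⟨hd.ne'⟩; rw [invMod_def, ZMod.natCast_zmod_val]

/-- `b̄` is prime to `d` when `b` is. [folklore] -/
theorem coprime_invMod {d b : ℕ} (hb : b.Coprime d) : (invMod d b).Coprime d := by
  have hu : (b : ZMod d) = ↑(ZMod.unitOfCoprime b hb) := (ZMod.coe_unitOfCoprime b hb).symm
  rw [invMod_def, hu, ZMod.inv_coe_unit]
  exact ZMod.val_coe_unit_coprime _

/-- `b̄̄ = b` for `(b,d)=1`, `b<d`. [folklore] -/
theorem invMod_invMod {d b : ℕ} (hd : 0 < d) (hb : b.Coprime d) (hbd : b < d) : invMod d (invMod d b) = b := by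
  haveI : NeZero d := ⟨hd.ne'⟩
  have hu : (b : ZMod d) = ↑(ZMod.unitOfCoprime b hb) := (ZMod.coe_unitOfCoprime b hb).symm
  have h1 : ((invMod d (invMod d b) : ℕ) : ZMod d) = (b : ZMod d) := by
    rw [natCast_invMod hd, natCast_invMod hd, hu, ZMod.inv_coe_unit, ZMod.inv_coe_unit, inv_inv]
  have h2 := congrArg ZMod.val h1
  rwa [ZMod.val_natCast, ZMod.val_natCast, Nat.mod_eq_of_lt (invMod_lt hd _), Nat.mod_eq_of_lt hbd] at h2

/-- For `(r, d) = (s, d) = 1`: the inverse class of `r s̄` is `s r̄`. [folklore] -/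
theorem invMod_congrSol {d r s : ℕ} (hd : 0 < d) (hr : r.Coprime d) (hs : s.Coprime d) :
    invMod d (congrSol d s r) = congrSol d r s := by
  haveI : NeZero d := ⟨hd.ne'⟩
  have hur : (r : ZMod d) = ↑(ZMod.unitOfCoprime r hr) := (ZMod.coe_unitOfCoprime r hr).symm
  have hus : (s : ZMod d) = ↑(ZMod.unitOfCoprime s hs) := (ZMod.coe_unitOfCoprime s hs).symm
  have h1 : ((invMod d (congrSol d s r) : ℕ) : ZMod d) = ((congrSol d r s : ℕ) : ZMod d) := by
    rw [natCast_invMod hd, congrSol_def, congrSol_def, ZMod.natCast_zmod_val, ZMod.natCast_zmod_val,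
      hur, hus, ZMod.inv_coe_unit, ZMod.inv_coe_unit, ← Units.val_mul, ← Units.val_mul, ZMod.inv_coe_unit,
      mul_inv_rev, inv_inv]
  have h2 := congrArg ZMod.val h1
  rwa [ZMod.val_natCast, ZMod.val_natCast, Nat.mod_eq_of_lt (invMod_lt hd _),
    Nat.mod_eq_of_lt (congrSol_lt hd _ _)] at h2

/-- `(r s̄, d) = 1` when `(r, d) = (s, d) = 1`. [folklore] -/
theorem coprime_congrSol {d r s : ℕ} (hr : r.Coprime d) (hs : s.Coprime d) :
    (congrSol d r s).Coprime d := by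
  have hur : (r : ZMod d) = ↑(ZMod.unitOfCoprime r hr) := (ZMod.coe_unitOfCoprime r hr).symm
  have hus : (s : ZMod d) = ↑(ZMod.unitOfCoprime s hs) := (ZMod.coe_unitOfCoprime s hs).symm
  rw [congrSol_def, hur, hus, ZMod.inv_coe_unit, ← Units.val_mul]
  exact ZMod.val_coe_unit_coprime _

/-- `(s r̄, d) ≠ 1` when `(r, d) = 1` but `(s, d) ≠ 1`. [folklore] -/
theorem not_coprime_congrSol {d r s : ℕ} (hd : 0 < d) (hr : r.Coprime d) (hs : ¬s.Coprime d) :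
    ¬(congrSol d r s).Coprime d := by
  haveI : NeZero d := ⟨hd.ne'⟩
  intro hc
  apply hs
  -- `s ≡ (s r̄) r (mod d)` is a product of units
  have h1 := dvd_sub_congrSol_mul hd hr s
  rw [← ZMod.intCast_zmod_eq_zero_iff_dvd] at h1
  push_cast at h1
  rw [sub_eq_zero] at h1
  have hu : IsUnit ((congrSol d r s : ℕ) : ZMod d) := (ZMod.isUnit_iff_coprime _ _).mpr hc
  have hu2 : IsUnit ((r : ℕ) : ZMod d) := (ZMod.isUnit_iff_coprime _ _).mpr hr
  have : IsUnit ((s : ℕ) : ZMod d) := by rw [h1]; exact hu.mul hu2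
  exact (ZMod.isUnit_iff_coprime s d).mp this

/-- **The symbol identity behind the symmetry:** for `(r, d) = (s, d) = 1`,
`χ_d(s r̄) χ_d(s) = χ_d(r)` (as `s ≡ (s r̄) r (mod d')` and `χ_d(s)² = 1`). [folklore] -/
theorem jtChar_congrSol_mul {d r s : ℕ} (hd : 0 < d) (hr : r.Coprime d) (hs : s.Coprime d) :
    jtChar d (congrSol d r s) * jtChar d s = jtChar d r := by
  set d' := ordCompl[2] d with hd'
  have hd'd : d' ∣ d := Nat.ordCompl_dvd d 2
  have hd'0 : 0 < d' := Nat.ordCompl_pos 2 hd.ne'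
  haveI : NeZero d' := ⟨hd'0.ne'⟩
  have h1 : (d' : ℤ) ∣ (s : ℤ) - (congrSol d r s : ℤ) * r :=
    (Int.natCast_dvd_natCast.mpr hd'd).trans (dvd_sub_congrSol_mul hd hr s)
  -- `J(s | d') = J((s r̄) r | d')`
  have h2 : J((s : ℤ) | d') = J((congrSol d r s : ℤ) * r | d') := by
    refine jacobiSym.mod_left' ?_
    have h' : (d' : ℤ) ∣ (congrSol d r s : ℤ) * r - s := by rw [← dvd_neg, neg_sub]; exact h1
    exact (Int.modEq_iff_dvd.mpr h').eq
  have hv2 : J((congrSol d r s : ℤ) | d') ^ 2 = 1 := by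
    refine jacobiSym.sq_one ?_
    rw [Int.gcd_natCast_natCast]
    exact (coprime_congrSol hr hs).coprime_dvd_right hd'd
  rw [jtChar_def, jtChar_def, jtChar_def, ← hd', h2, jacobiSym.mul_left, ← mul_assoc, ← sq, hv2, one_mul]





/-- **The switched vector** `γ'_d(b) = γ_d(b̄) χ_d(b̄)` for `(b, d) = 1` (and `0` otherwise) ("if we
switch `r` with `s` and also change `γ_{ad}` to `γ_{ad} (a/d')` then `W*(D)` is not altered").
[cite: FriedlanderIwaniecAnnals1998, §11, before (11.24)] -/
def jtFlip (γ : ℕ → ℕ → ℂ) (d b : ℕ) : ℂ :=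
  if b.Coprime d then γ d (invMod d b) * (jtChar d (invMod d b) : ℂ) else 0

/-- Unfolding `jtFlip`. [folklore] -/
theorem jtFlip_def (γ : ℕ → ℕ → ℂ) (d b : ℕ) :
    jtFlip γ d b = if b.Coprime d then γ d (invMod d b) * (jtChar d (invMod d b) : ℂ) else 0 := rfl

/-- `|χ_d(a)| = 1` for `(a, d) = 1`. [folklore] -/
theorem norm_jtChar_eq_one {d a : ℕ} (hd : 0 < d) (ha : a.Coprime d) : ‖(jtChar d a : ℂ)‖ = 1 := by
  have hd'0 : ordCompl[2] d ≠ 0 := (Nat.ordCompl_pos 2 hd.ne').ne'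
  haveI : NeZero (ordCompl[2] d) := ⟨hd'0⟩
  have hne : jtChar d a ≠ 0 := by
    rw [jtChar_def, Ne, jacobiSym.eq_zero_iff_not_coprime, Int.gcd_natCast_natCast, not_not]
    exact ha.coprime_dvd_right (Nat.ordCompl_dvd d 2)
  rw [Complex.norm_intCast]
  rcases jacobiSym.trichotomy (a : ℤ) (ordCompl[2] d) with h | h | h
  · exact absurd h hne
  · rw [jtChar_def, h]; simp
  · rw [jtChar_def, h]; simp

/-- The switched vector is supported on the unit classes. [folklore] -/
theorem isUnitSupported_jtFlip (D₁ D₂ : ℕ) (γ : ℕ → ℕ → ℂ) : IsUnitSupported D₁ D₂ (jtFlip γ) :=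
  fun d _ a _ ha => by rw [jtFlip_def, if_neg ha]

/-- **`‖γ'‖ = ‖γ‖`** for `γ` supported on the unit classes. [folklore] -/
theorem jtNormSq_jtFlip {D₁ D₂ : ℕ} {γ : ℕ → ℕ → ℂ} (hγ : IsUnitSupported D₁ D₂ γ) :
    jtNormSq D₁ D₂ (jtFlip γ) = jtNormSq D₁ D₂ γ := by
  rw [jtNormSq_def, jtNormSq_def]
  refine sum_congr rfl fun d hd => ?_
  have hd0 : 0 < d := by rw [mem_Ioc] at hd; omega
  -- both sides are sums over the unit classes
  have hL : ∑ b ∈ range d, ‖jtFlip γ d b‖ ^ 2 =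
      ∑ b ∈ (range d).filter (fun b => b.Coprime d), ‖γ d (invMod d b)‖ ^ 2 := by
    rw [sum_filter]
    refine sum_congr rfl fun b _ => ?_
    rw [jtFlip_def]
    split_ifs with hb
    · rw [norm_mul, norm_jtChar_eq_one hd0 (coprime_invMod hb), mul_one]
    · simp
  have hR : ∑ a ∈ range d, ‖γ d a‖ ^ 2 = ∑ a ∈ (range d).filter (fun a => a.Coprime d), ‖γ d a‖ ^ 2 := by
    rw [sum_filter]
    refine sum_congr rfl fun a ha => ?_
    split_ifs with hac
    · rfl
    · rw [hγ d hd a (mem_range.mp ha) hac, norm_zero, zero_pow two_ne_zero]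
  rw [hL, hR]
  refine sum_nbij' (fun b => invMod d b) (fun a => invMod d a) ?_ ?_ ?_ ?_ ?_
  · intro b hb
    rw [mem_filter, mem_range] at hb ⊢
    exact ⟨invMod_lt hd0 b, coprime_invMod hb.2⟩
  · intro a ha
    rw [mem_filter, mem_range] at ha ⊢
    exact ⟨invMod_lt hd0 a, coprime_invMod ha.2⟩
  · intro b hb
    rw [mem_filter, mem_range] at hb
    exact invMod_invMod hd0 hb.2 hb.1
  · intro a ha
    rw [mem_filter, mem_range] at ha
    exact invMod_invMod hd0 ha.2 ha.1
  · intro b _; rfl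

/-- **The symmetry `r ↔ s`** for `γ` supported on the unit classes:
`W(γ; R, S) = W(γ'; S, R)` (term by term: for `(r,d) = (s,d) = 1` the class `r s̄` is the inverse of
`s r̄` and `χ_d(s r̄) χ_d(s) = χ_d(r)`; if exactly one of `r, s` is prime to `d` both terms vanish,
on one side by the support of `γ`). [cite: FriedlanderIwaniecAnnals1998, §11, before (11.24)] -/
theorem jtW_eq_jtW_jtFlip {D₁ D₂ : ℕ} {γ : ℕ → ℕ → ℂ} (hγ : IsUnitSupported D₁ D₂ γ) (R S : ℕ) :
    jtW D₁ D₂ R S γ = jtW D₁ D₂ S R (jtFlip γ) := by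
  rw [jtW_eq_sum_congrSol, jtW_eq_sum_congrSol]
  conv_rhs => rw [sum_comm]
  refine sum_congr rfl fun r _ => sum_congr rfl fun s _ => ?_
  congr 2
  rw [sum_filter, sum_filter]
  refine sum_congr rfl fun d hd => ?_
  have hd0 : 0 < d := by rw [mem_Ioc] at hd; omega
  by_cases hr : r.Coprime d
  · by_cases hs : s.Coprime d
    · rw [if_pos hr, if_pos hs, jtFlip_def, if_pos (coprime_congrSol hs hr), invMod_congrSol hd0 hr hs,
        mul_assoc, ← Int.cast_mul, jtChar_congrSol_mul hd0 hr hs]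
    · rw [if_pos hr, if_neg hs, hγ d hd _ (congrSol_lt hd0 r s) (not_coprime_congrSol hd0 hr hs), zero_mul]
  · by_cases hs : s.Coprime d
    · rw [if_neg hr, if_pos hs, jtFlip_def, if_neg (not_coprime_congrSol hd0 hs hr), zero_mul]
    · rw [if_neg hr, if_neg hs]

/-- **FI (11.24)** (symmetric form, for vectors supported on the unit classes): for `0 < ε ≤ 1` there
is `C` with, for all `D₁, D₂`, `R, S ≥ 1` and `γ` supported on the unit classes,
`W ≤ C {RS√D₂/(D₁+1) + (S R^{3/4} + R S^{3/4} + D₂√(RS)) (D₂RS)^ε} ‖γ‖²`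
("due to this symmetry we may assume that `R ≤ S`. Applying (11.23) we get (11.24)": if `R ≤ S` then
`D₂R ≤ D₂√(RS)`; otherwise switch `r` and `s`). [cite: FriedlanderIwaniecAnnals1998, §11, (11.24)] -/
theorem exists_jtW_le_unitSupported {ε : ℝ} (hε : 0 < ε) (hε1 : ε ≤ 1) :
    ∃ C : ℝ, 0 < C ∧ ∀ (D₁ D₂ R S : ℕ) (γ : ℕ → ℕ → ℂ), 1 ≤ R → 1 ≤ S → IsUnitSupported D₁ D₂ γ →
      jtW D₁ D₂ R S γ ≤ C * ((R : ℝ) * S * Real.sqrt D₂ / (D₁ + 1) +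
        ((S : ℝ) * (R : ℝ) ^ (3 / 4 : ℝ) + (R : ℝ) * (S : ℝ) ^ (3 / 4 : ℝ) + D₂ * Real.sqrt ((R : ℝ) * S)) *
          ((D₂ : ℝ) * R * S) ^ ε) * jtNormSq D₁ D₂ γ := by
  obtain ⟨C, hC0, hC⟩ := exists_jtW_le hε hε1
  refine ⟨2 * C, by positivity, fun D₁ D₂ R S γ hR hS hγ => ?_⟩
  have hγ0 : 0 ≤ jtNormSq D₁ D₂ γ := jtNormSq_nonneg _ _ _
  have hR0 : (0 : ℝ) ≤ R := Nat.cast_nonneg R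
  have hS0 : (0 : ℝ) ≤ S := Nat.cast_nonneg S
  have hD0 : (0 : ℝ) ≤ D₂ := Nat.cast_nonneg D₂
  set A : ℝ := (R : ℝ) * S * Real.sqrt D₂ / (D₁ + 1) with hA
  set T : ℝ := (S : ℝ) * (R : ℝ) ^ (3 / 4 : ℝ) + (R : ℝ) * (S : ℝ) ^ (3 / 4 : ℝ) + D₂ * Real.sqrt ((R : ℝ) * S)
    with hT
  set P : ℝ := ((D₂ : ℝ) * R * S) ^ ε with hP
  have hA0 : 0 ≤ A := by positivity
  have hP0 : 0 ≤ P := by positivity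
  have hsqrtRS : 0 ≤ Real.sqrt ((R : ℝ) * S) := Real.sqrt_nonneg _
  have h34R : 0 ≤ (S : ℝ) * (R : ℝ) ^ (3 / 4 : ℝ) := by positivity
  have h34S : 0 ≤ (R : ℝ) * (S : ℝ) ^ (3 / 4 : ℝ) := by positivity
  rcases le_or_gt R S with hRS | hSR
  · -- `R ≤ S`: (11.23) directly, `D₂ R ≤ D₂ √(RS)`
    have h := hC D₁ D₂ R S γ hR hS
    have hRle : (R : ℝ) ≤ Real.sqrt ((R : ℝ) * S) := by
      rw [Real.le_sqrt hR0 (by positivity), sq]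
      exact mul_le_mul_of_nonneg_left (by exact_mod_cast hRS) hR0
    have hcoef : (S : ℝ) * (R : ℝ) ^ (3 / 4 : ℝ) + D₂ * R + D₂ * Real.sqrt ((R : ℝ) * S) ≤ 2 * T := by
      rw [hT]
      have : (D₂ : ℝ) * R ≤ D₂ * Real.sqrt ((R : ℝ) * S) := mul_le_mul_of_nonneg_left hRle hD0
      nlinarith [mul_nonneg hD0 hsqrtRS]
    calc jtW D₁ D₂ R S γ ≤ C * (A + ((S : ℝ) * (R : ℝ) ^ (3 / 4 : ℝ) + D₂ * R + D₂ * Real.sqrt ((R : ℝ) * S)) * P) *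
          jtNormSq D₁ D₂ γ := h
      _ ≤ C * (A + 2 * T * P) * jtNormSq D₁ D₂ γ := by
          refine mul_le_mul_of_nonneg_right (mul_le_mul_of_nonneg_left ?_ hC0.le) hγ0
          nlinarith [mul_le_mul_of_nonneg_right hcoef hP0]
      _ ≤ 2 * C * (A + T * P) * jtNormSq D₁ D₂ γ := by
          have : 0 ≤ C * A * jtNormSq D₁ D₂ γ := by positivity
          nlinarith
  · -- `S < R`: switch `r` and `s`
    have hflip := jtW_eq_jtW_jtFlip hγ R S
    have h := hC D₁ D₂ S R (jtFlip γ) hS hR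
    rw [jtNormSq_jtFlip hγ] at h
    have hSle : (S : ℝ) ≤ Real.sqrt ((R : ℝ) * S) := by
      rw [Real.le_sqrt hS0 (by positivity), sq]
      exact mul_le_mul_of_nonneg_right (by exact_mod_cast hSR.le) hS0
    have e1 : (S : ℝ) * R * Real.sqrt D₂ / (D₁ + 1) = A := by rw [hA]; ring
    have e2 : Real.sqrt ((S : ℝ) * R) = Real.sqrt ((R : ℝ) * S) := by rw [mul_comm]
    have e3 : ((D₂ : ℝ) * S * R) ^ ε = P := by rw [hP]; ring_nf
    rw [e1, e2, e3] at h
    have hcoef : (R : ℝ) * (S : ℝ) ^ (3 / 4 : ℝ) + D₂ * S + D₂ * Real.sqrt ((R : ℝ) * S) ≤ 2 * T := by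
      rw [hT]
      have : (D₂ : ℝ) * S ≤ D₂ * Real.sqrt ((R : ℝ) * S) := mul_le_mul_of_nonneg_left hSle hD0
      nlinarith [mul_nonneg hD0 hsqrtRS]
    calc jtW D₁ D₂ R S γ = jtW D₁ D₂ S R (jtFlip γ) := hflip
      _ ≤ C * (A + ((R : ℝ) * (S : ℝ) ^ (3 / 4 : ℝ) + D₂ * S + D₂ * Real.sqrt ((R : ℝ) * S)) * P) *
          jtNormSq D₁ D₂ γ := h
      _ ≤ C * (A + 2 * T * P) * jtNormSq D₁ D₂ γ := by
          refine mul_le_mul_of_nonneg_right (mul_le_mul_of_nonneg_left ?_ hC0.le) hγ0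
          nlinarith [mul_le_mul_of_nonneg_right hcoef hP0]
      _ ≤ 2 * C * (A + T * P) * jtNormSq D₁ D₂ γ := by
          have : 0 ≤ C * A * jtNormSq D₁ D₂ γ := by positivity
          nlinarith


end Literature.NumberTheory.Sieve.FriedlanderIwaniecPrimes
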